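import Literature.NumberTheory.EllipticCurves.IwasawaEulerCharDualityProofs
import HarnessLib

/-!
# STUB-IDEAS k1 (gen 10) — `stub_heegnerIndexLowerAtTwo` · crux stmt-BirchSwinnertonDyer-27851 (`PrintCf2.SplitBadTwoLowerHalfOfFacts`)
# TECHNIQUE «weaken / strengthen»: EXACT DESCENT AT THE CALIBRATION CURVE — arm M's slack IS the anchor's descent defect `Δ₀`

Seat `planner-sidea-stub_heegnerIndexLowerAtTwo-1-g10-0` (stub-ideation, k = 1, gen 10). Typed sketch accompanying the card
`Ideas/stub_heegnerIndexLowerAtTwo-k1.md` (gate slug `stub-heegnerindexloweratwo-k1-g10`). HONEST FRAMING: nothing here closes the crux,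
the stub or any registered item; BSD is NOT proved by any of this; no summit statement is proved. No `sorry`, no new `instance`,
no `notation`, no named fact. Everything is either linear bookkeeping over `ℤ` (in the variables of the critic's certificate
`StubPlanT2LowerOneSidedControl.lean :: lower_chain`) or a four-line lemma on `EndCoinvariants` (tree abbreviation, CSS (30)).

THE POINT (§A). The plan of record (STUB-PLAN v2.6 §4, T3.6 arm M = k1-g8 CAL + k1-g9 floor) calibrates the key-rigid offset
`e_M − e_A` of the LOWER chain at ONE BSD-certified member `W₀` per dyadic key and sends the anchor VALUE to the kit (R66 (iii)).
Written out, the calibration consumes at `W₀` (i) the EULER-SYSTEM direction of the main conjecture (`2n₀ + e_M ≤ m₀`, the half B1 says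
the LOWER child never uses — `containment_only_does_not_calibrate` is the countermodel) and (ii) the FULL four-index control identity
`n₀ + v₂ #𝔖_Γ + v₂ #ker = v₂ #𝔖_{v̄}(K, W*) + v₂ [coker]` (tree: `control_identity_endEigenPrimaryTorsion`, p652120) — the two terms the
T2 certificate drops as «the parent's business» are charged IN FULL at the anchor. Result (`armM_member_bound`): arm M proves at every member
of the key class EXACTLY `A ≤ B₁ + Δ₀`, `Δ₀ = φ₀ + kk₀ + β₀ + κ₀ ≥ 0` the anchor's total descent defect measured against the SAME one-sided
tables the members use (`φ₀ = v₂ #𝔖_Γ`, `kk₀ = v₂ #ker(control)`, `β₀ = B₀ + t − b₀` bottom slack, `κ₀ = k − c₀` cokernel slack). So the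
slack-3 budget of k1-g9 reads `Δ₀ ≤ 1` (+ parity), sharpness reads `Δ₀ = 0`, and `kit_reads_twice_defect` says R66 (iii) measures `2Δ₀`.
§B: the structural digit `φ₀` vanishes under «no proper finite-index `γ`-stable subgroup» (discrete form of B17), four lines.
References: [Agboola2007] §5–§6, Prop. 8.1; [GreenbergLNM1716] §4 Props. 4.14–4.15; [CoatesSchneiderSujatha2003] §3 (30)–(31).
-/

set_option autoImplicit false
set_option linter.dupNamespace false

namespace Summit.BirchSwinnertonDyer.BirchSwinnertonDyer.Cruxes.SplitBadTwoLowerHalfOfFacts.StubIdeasK1G10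

/-! ## §A. Exact descent at the calibration curve (pure bookkeeping, variables of `LowerStubControl.lower_chain`)

Member `W` of the key class: `m = 2A + e_A` (S2′), `m ≤ 2n + e_M` (MC containment), `n ≤ b + c` (one-sided control), `b ≤ B₁ + t`,
`c ≤ k` — `t`, `k`, `e_A`, `e_M` key-rigid tables (k1-g8 §D / k1-g9 `Shape`). Anchor `W₀` of the same key: the same `e_A`, `e_M`, `t`, `k`;
its ACTUAL digits `m₀ n₀ b₀ c₀ φ₀ kk₀`, BSD₂ known there (`A₀ = B₀`). -/

/-- (ES-direction at the anchor.) The Euler-system half of the main conjecture at `W₀` (`2n₀ + e_M ≤ m₀`), S2′ at `W₀`, the FULL control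
identity at `W₀` and BSD₂ at `W₀` bound the offset `e_M − e_A` ABOVE by anchor data alone. [this sketch] -/
theorem anchor_offset_le {A₀ B₀ m₀ n₀ b₀ c₀ φ₀ kk₀ e_A e_M : ℤ}
    (hS2₀ : m₀ = 2 * A₀ + e_A) (hES₀ : 2 * n₀ + e_M ≤ m₀) (hctl₀ : n₀ + φ₀ + kk₀ = b₀ + c₀) (hBSD₀ : A₀ = B₀) :
    e_M - e_A ≤ 2 * (B₀ + φ₀ + kk₀) - 2 * (b₀ + c₀) := by
  omega

/-- (Equality at the anchor.) With main-conjecture EQUALITY at `W₀` the offset is DETERMINED: `e_M − e_A = 2(B₀ + φ₀ + kk₀) − 2(b₀ + c₀)`.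
[this sketch] -/
theorem anchor_offset_eq {A₀ B₀ m₀ n₀ b₀ c₀ φ₀ kk₀ e_A e_M : ℤ}
    (hS2₀ : m₀ = 2 * A₀ + e_A) (hMC₀ : m₀ = 2 * n₀ + e_M) (hctl₀ : n₀ + φ₀ + kk₀ = b₀ + c₀) (hBSD₀ : A₀ = B₀) :
    e_M - e_A = 2 * (B₀ + φ₀ + kk₀) - 2 * (b₀ + c₀) := by
  omega

/-- **Arm M's member bound is exactly `A ≤ B₁ + Δ₀`.** The member's one-sided chain (`lower_chain`'s five hypotheses) plus the anchor's
calibration (`anchor_offset_le`'s four) give `2A ≤ 2B₁ + 2Δ₀` with `Δ₀ = φ₀ + kk₀ + β₀ + κ₀`, where `β₀ := B₀ + t − b₀` and `κ₀ := k − c₀`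
are the anchor's slacks against the member tables `t`, `k`. The member's OWN dropped terms never enter. [this sketch] -/
theorem armM_member_bound {A B₁ m n b c t k e_A e_M A₀ B₀ m₀ n₀ b₀ c₀ φ₀ kk₀ β₀ κ₀ : ℤ}
    (hS2 : m = 2 * A + e_A) (hMC : m ≤ 2 * n + e_M) (hctl : n ≤ b + c) (hbot : b ≤ B₁ + t) (hcok : c ≤ k)
    (hS2₀ : m₀ = 2 * A₀ + e_A) (hES₀ : 2 * n₀ + e_M ≤ m₀) (hctl₀ : n₀ + φ₀ + kk₀ = b₀ + c₀) (hBSD₀ : A₀ = B₀)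
    (hβ₀ : b₀ + β₀ = B₀ + t) (hκ₀ : c₀ + κ₀ = k) :
    2 * A ≤ 2 * B₁ + 2 * (φ₀ + kk₀ + β₀ + κ₀) := by
  omega

/-- Sharp anchor (`Δ₀ = 0`: no finite-index stable subgroup, kernel missed, bottom formula and cokernel bound EXACT at `W₀`) ⟹ the stub's
inequality `A ≤ B₁` at every member of the key, with no `+1` and no parity row. [this sketch] -/
theorem armM_sharp {A B₁ m n b c t k e_A e_M A₀ B₀ m₀ n₀ b₀ c₀ : ℤ}
    (hS2 : m = 2 * A + e_A) (hMC : m ≤ 2 * n + e_M) (hctl : n ≤ b + c) (hbot : b ≤ B₁ + t) (hcok : c ≤ k)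
    (hS2₀ : m₀ = 2 * A₀ + e_A) (hES₀ : 2 * n₀ + e_M ≤ m₀) (hctl₀ : n₀ = b₀ + c₀) (hBSD₀ : A₀ = B₀)
    (hβ₀ : b₀ = B₀ + t) (hκ₀ : c₀ = k) :
    A ≤ B₁ := by
  omega

/-- Defect-one anchor (`Δ₀ ≤ 1`) ⟹ `A ≤ B₁ + 1` — the regime the parity row (STUB-PLAN k1 plan A / B-parity) closes when `A ≡ B₁ (mod 2)`;
`Δ₀ ≥ 2` leaves arm M short by a full unit at that key whatever the analytic side does. [this sketch] -/
theorem armM_slack_one {A B₁ m n b c t k e_A e_M A₀ B₀ m₀ n₀ b₀ c₀ φ₀ kk₀ β₀ κ₀ : ℤ}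
    (hS2 : m = 2 * A + e_A) (hMC : m ≤ 2 * n + e_M) (hctl : n ≤ b + c) (hbot : b ≤ B₁ + t) (hcok : c ≤ k)
    (hS2₀ : m₀ = 2 * A₀ + e_A) (hES₀ : 2 * n₀ + e_M ≤ m₀) (hctl₀ : n₀ + φ₀ + kk₀ = b₀ + c₀) (hBSD₀ : A₀ = B₀)
    (hβ₀ : b₀ + β₀ = B₀ + t) (hκ₀ : c₀ + κ₀ = k) (hΔ : φ₀ + kk₀ + β₀ + κ₀ ≤ 1) (hpar : A % 2 = B₁ % 2) :
    A ≤ B₁ := by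
  omega

/-- The budget is TIGHT: under main-conjecture equality and exact bookkeeping at the member as well, `A − B₁ = Δ₀ − Δ(W)` — a member whose
own defect `Δ(W)` is smaller than the anchor's sits strictly above `B₁` in the chain's currency, so no re-typing of the analytic side can
recover what a defective anchor loses. [this sketch] -/
theorem member_gap_eq_anchor_defect_sub_member_defect {A B₁ m n b c t k e_A e_M A₀ B₀ m₀ n₀ b₀ c₀ φ kk β κ φ₀ kk₀ β₀ κ₀ : ℤ}
    (hS2 : m = 2 * A + e_A) (hMC : m = 2 * n + e_M) (hctl : n + φ + kk = b + c) (hβ : b + β = B₁ + t) (hκ : c + κ = k)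
    (hS2₀ : m₀ = 2 * A₀ + e_A) (hMC₀ : m₀ = 2 * n₀ + e_M) (hctl₀ : n₀ + φ₀ + kk₀ = b₀ + c₀) (hBSD₀ : A₀ = B₀)
    (hβ₀ : b₀ + β₀ = B₀ + t) (hκ₀ : c₀ + κ₀ = k) :
    A - B₁ = (φ₀ + kk₀ + β₀ + κ₀) - (φ + kk + β + κ) := by
  omega

/-- **Containment alone does not calibrate** (why (i) is consumed): integers satisfying the member chain, the anchor chain with
CONTAINMENT only (`m₀ ≤ 2n₀ + e_M`), BSD₂ at the anchor and a defect-free anchor, yet `A = B₁ + 500`. [this sketch] -/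
theorem containment_only_does_not_calibrate :
    ∃ A B₁ m n b c t k e_A e_M A₀ B₀ m₀ n₀ b₀ c₀ : ℤ,
      m = 2 * A + e_A ∧ m ≤ 2 * n + e_M ∧ n ≤ b + c ∧ b ≤ B₁ + t ∧ c ≤ k ∧
      m₀ = 2 * A₀ + e_A ∧ m₀ ≤ 2 * n₀ + e_M ∧ n₀ = b₀ + c₀ ∧ A₀ = B₀ ∧ b₀ = B₀ + t ∧ c₀ = k ∧
      A = B₁ + 500 :=
  ⟨500, 0, 1000, 0, 0, 0, 0, 0, 0, 1000, 0, 0, 0, 0, 0, 0, by norm_num⟩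

/-- **What R66 (iii) measures.** With `m₀ = 2g₀` (`g₀` = the 2-adic order of the anchor's Katz/Rubin value) and main-conjecture equality at
`W₀`: `2g₀ = 2(B₀ + t + k) + e_M − 2Δ₀` — the kit column (iii) reads the anchor's TOTAL DESCENT DEFECT (twice), nothing else; conversely a
certified `g₀` DETERMINES the structural digit `φ₀ = v₂ #𝔖_Γ` once the three finite-descent digits `kk₀ β₀ κ₀` are known. [this sketch] -/
theorem kit_reads_twice_defect {g₀ B₀ m₀ n₀ b₀ c₀ φ₀ kk₀ β₀ κ₀ t k e_M : ℤ}
    (hm₀ : m₀ = 2 * g₀) (hMC₀ : m₀ = 2 * n₀ + e_M) (hctl₀ : n₀ + φ₀ + kk₀ = b₀ + c₀)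
    (hβ₀ : b₀ + β₀ = B₀ + t) (hκ₀ : c₀ + κ₀ = k) :
    2 * g₀ = 2 * (B₀ + t + k) + e_M - 2 * (φ₀ + kk₀ + β₀ + κ₀) := by
  omega

/-- A class-uniform sharpening of a member table by one unit (e.g. the landed halving `[coker]·2 ∣ ∏ #LK` under (H7),
`two_mul_relIndex_control_of_frame_dvd_of_not_decomp_le`, i.e. `k ↦ k − 1` for members AND anchor) lowers arm M's member bound by exactly one
unit of `A`: the anchor contributes its ACTUAL `c₀`, the members their TABLE. [this sketch] -/
theorem armM_member_bound_halved {A B₁ m n b c t k e_A e_M A₀ B₀ m₀ n₀ b₀ c₀ φ₀ kk₀ β₀ κ₀ : ℤ}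
    (hS2 : m = 2 * A + e_A) (hMC : m ≤ 2 * n + e_M) (hctl : n ≤ b + c) (hbot : b ≤ B₁ + t) (hcok' : c ≤ k - 1)
    (hS2₀ : m₀ = 2 * A₀ + e_A) (hES₀ : 2 * n₀ + e_M ≤ m₀) (hctl₀ : n₀ + φ₀ + kk₀ = b₀ + c₀) (hBSD₀ : A₀ = B₀)
    (hβ₀ : b₀ + β₀ = B₀ + t) (hκ₀ : c₀ + κ₀ = k) :
    2 * A ≤ 2 * B₁ + 2 * (φ₀ + kk₀ + β₀ + κ₀) - 2 := by
  omega

/-! ## §B. The structural digit: `φ₀ = 0` under «no proper finite-index `γ`-stable subgroup» (discrete form of B17)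

`S` = the restricted Selmer group `𝔖_{v̄}(K*_∞, W*)` as an abelian group, `γ` = the action of a topological generator
(`Agboola2007.conjRestricted κ M 𝔮 γ`); `EndCoinvariants (γ − 1) = S ⧸ (γ − 1)S = 𝔖_Γ` (tree abbreviation). Pontryagin-dually a finite-index
`γ`-stable subgroup of `S` is a nonzero finite `Λ`-submodule of `X = S^∨`, so `NoFiniteIndexStable γ` is B17 read on `S` itself; the tree's
road-α form is the twisted surjectivity `natCard_endCoinvariants_eq_one_of_twistedCoinvariants` (p660647). -/

section Structural

open Literature.NumberTheory.EllipticCurves.IwasawaDual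

variable {S : Type*} [AddCommGroup S]

/-- `(γ − 1)S` is `γ`-stable (`γ` commutes with `γ − 1`). [folklore] -/
theorem range_sub_one_stable (γ : AddMonoid.End S) :
    ∀ s ∈ AddMonoidHom.range (AddMonoidHomClass.toAddMonoidHom (γ - 1)), γ s ∈
      AddMonoidHom.range (AddMonoidHomClass.toAddMonoidHom (γ - 1)) := by
  intro s hs
  obtain ⟨t, rfl⟩ := AddMonoidHom.mem_range.mp hs
  refine AddMonoidHom.mem_range.mpr ⟨γ t, ?_⟩
  have h1 : ∀ x : S, (γ - 1) x = γ x - x := fun x ↦ rfl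
  rw [AddMonoidHom.coe_coe, h1, h1, map_sub]

/-- **`φ₀ = 0`:** if `S` has no proper finite-index `γ`-stable subgroup («`S_M(F_∞)` has no proper `Λ`-submodules of finite index»,
Greenberg LNM 1716 Props. 4.14–4.15, read on the discrete side = B17 for the dual) and `𝔖_Γ = S ⧸ (γ − 1)S` is finite (which the anchor's
control identity supplies), then `𝔖_Γ` is trivial. [cite: GreenbergLNM1716, §4 Props. 4.14–4.15] -/
theorem subsingleton_endCoinvariants_of_noFiniteIndexStable (γ : AddMonoid.End S)
    (h : ∀ H : AddSubgroup S, (∀ s ∈ H, γ s ∈ H) → H.FiniteIndex → H = ⊤)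
    [Finite (EndCoinvariants (γ - 1))] : Subsingleton (EndCoinvariants (γ - 1)) := by
  have hfi : (AddMonoidHom.range (AddMonoidHomClass.toAddMonoidHom (γ - 1))).FiniteIndex :=
    AddSubgroup.finiteIndex_of_finite_quotient
  have htop := h _ (range_sub_one_stable γ) hfi
  refine ⟨fun x y ↦ ?_⟩
  induction x using QuotientAddGroup.induction_on with
  | H a =>
    induction y using QuotientAddGroup.induction_on with
    | H b => exact QuotientAddGroup.eq.mpr (htop ▸ AddSubgroup.mem_top _)

/-- Hence `#𝔖_Γ = 1` and its `p`-adic digit `φ₀ = v_p #𝔖_Γ = 0`. [cite: GreenbergLNM1716, §4 Props. 4.14–4.15] -/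
theorem padicValNat_card_endCoinvariants_eq_zero (p : ℕ) (γ : AddMonoid.End S)
    (h : ∀ H : AddSubgroup S, (∀ s ∈ H, γ s ∈ H) → H.FiniteIndex → H = ⊤)
    [Finite (EndCoinvariants (γ - 1))] : padicValNat p (Nat.card (EndCoinvariants (γ - 1))) = 0 := by
  haveI := subsingleton_endCoinvariants_of_noFiniteIndexStable γ h
  rw [Nat.card_unique, padicValNat_one_right]

end Structural

end Summit.BirchSwinnertonDyer.BirchSwinnertonDyer.Cruxes.SplitBadTwoLowerHalfOfFacts.StubIdeasK1G10
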